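import Summits.BirchSwinnertonDyer.BirchSwinnertonDyer.Theorems.PrintCFramBottomClassIndexLawFiveLeFlipRungTwistVehicle
import HarnessLib

set_option autoImplicit false

/-!
# Crux `PrintCFram.BottomClassIndexLawFiveLe` (stmt-BirchSwinnertonDyer-20372), line `eisenstein-resource-bdp-line` (registry v27,
# `stub_flipRung`): THE PERIODIC CUT WITH ITS FUNCTION EXPOSED — `Σ_j (Q⁻¹𝓕a)(j)·F(· + j/Q)` is a `Γ₁(L Q²)`-form with q-expansion `a(n)·c(n)`
# (cell `bsd-print-cfram`, width seat `bsd-line-cfram-p1-w3` g19; THEOREMS ONLY, `--supports` 20372; BSD is not proved by any of this)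

HONEST FRAMING. Nothing here is a statement about elliptic curves or BSD; no registered stub is closed. Sequel to `…FlipRungTwistVehicle`
(`exists_modularForm_translateSum_coe_eq`: translate sums with arbitrary weights `b`, function and q-expansion `(Σ_j b_j ψ_Q(jn))·c(n)` exposed).
Here the weights are the finite Fourier transform `b = Q⁻¹·𝓕a` of a prescribed multiplier `a : ℤ/Q → ℂ`, so that the q-expansion is
`a(n)·c(n)` (Fourier inversion on `ℤ/Qℤ`, Mathlib `ZMod.dft` / `ZMod.invDFT_apply`; the Literature file `ModularFormPeriodicTwist` keeps this
step private) — in particular the CUT along a `Q`-periodic index predicate `P` (`a = 𝟙_P`), which is the away-from-`q` vehicle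
`F₀ = cut_AWAY(H_k·θ(R²·))` of seat w4 g19's modular assembly (item (2), HOME/STATUS 2026-08-29T08:13:06Z) AS A FUNCTION (so that w4 g19's
`vehicle_slash_eq` — `hinv` for translate sums with ANY weights — applies to it) together with its q-expansion `𝟙_AWAY(n)·(H ⋆ Θ)(n)`.
* `sum_inv_smul_dft_mul_stdAddChar` — `Σ_j (Q⁻¹𝓕a)(j)·ψ_Q(j n) = a(n)`;
* `exists_modularForm_periodicTwist_coe_eq` — multiplier `a : ZMod Q → ℂ`; `exists_modularForm_periodicCut_coe_eq` — cut along a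
  `Q`-periodic predicate `P : ℕ → Prop`: `coeff n = if P n then coeff n F else 0`, function `= Σ_j b_j F(· + j/Q)` with explicit `b`.
No new definitions, no named facts, no `sorry`. beyond-print theorem: NO (Shimura 1971 Prop. 3.64). BSD is not proved by any of this.

References: [Shimura1971] Prop. 3.64; [KoblitzECMF1993] III §3 Prop. 17.
-/

-- summit-side namespace `Summit.BirchSwinnertonDyer.BirchSwinnertonDyer.…` (single-conjunct summit, D-0017 layout)
set_option linter.dupNamespace false

noncomputable section

namespace Summit.BirchSwinnertonDyer.BirchSwinnertonDyer.Theorems.PrintCFram.FlipRung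

open UpperHalfPlane Filter Function Complex CongruenceSubgroup PowerSeries
open scoped MatrixGroups ModularForm Topology Manifold Real

/-- **Fourier inversion on `ℤ/Qℤ`** in the form used for twisting: with `b = Q⁻¹ • 𝓕a` (Mathlib `ZMod.dft`),
`Σ_j b(j) ψ_Q(j n) = a(n)` (`ZMod.invDFT_apply`). [folklore] -/
theorem sum_inv_smul_dft_mul_stdAddChar {Q : ℕ} [NeZero Q] (a : ZMod Q → ℂ) (n : ZMod Q) :
    ∑ j : ZMod Q, ((Q : ℂ)⁻¹ • ZMod.dft a) j * ZMod.stdAddChar (j * n) = a n := by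
  have hQ : (Q : ℂ) ≠ 0 := Nat.cast_ne_zero.mpr (NeZero.ne Q)
  have h1 := ZMod.invDFT_apply ((Q : ℂ)⁻¹ • ZMod.dft a) n
  rw [LinearEquiv.map_smul, LinearEquiv.symm_apply_apply, Pi.smul_apply, smul_eq_mul, smul_eq_mul] at h1
  have h2 := congrArg (fun z : ℂ ↦ (Q : ℂ) * z) h1
  simp only [← mul_assoc, mul_inv_cancel₀ hQ, one_mul] at h2
  rw [h2]
  exact Finset.sum_congr rfl fun j _ ↦ by rw [smul_eq_mul, mul_comm]

/-- **Periodic twist with prescribed multiplier, function exposed.** For `F : ModularForm (Gamma1 L) k`, `Q ≥ 1` and `a : ℤ/Q → ℂ`: with the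
explicit weights `b = Q⁻¹ • 𝓕a`, the translate sum `z ↦ Σ_j b(j) F((j.val/Q) +ᵥ z)` is (the function of) a `ModularForm (Gamma1 (L Q²)) k`
whose q-expansion is `coeff n = a(n) · coeff n (qExpansion 1 F)`. [cite: Shimura1971, Prop. 3.64] -/
theorem exists_modularForm_periodicTwist_coe_eq {L : ℕ} [NeZero L] {k : ℤ} (F : ModularForm (Gamma1 L) k) (Q : ℕ) [NeZero Q]
    (a : ZMod Q → ℂ) :
    ∃ g : ModularForm (Gamma1 (L * Q ^ 2)) k,
      (∀ z : ℍ, g z = ∑ j : ZMod Q, ((Q : ℂ)⁻¹ • ZMod.dft a) j * F (((j.val : ℝ) / (Q : ℝ)) +ᵥ z)) ∧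
      ∀ n : ℕ, (qExpansion 1 ⇑g).coeff n = a n * (qExpansion 1 ⇑F).coeff n := by
  obtain ⟨g, hg, hc⟩ := exists_modularForm_translateSum_coe_eq F Q ((Q : ℂ)⁻¹ • ZMod.dft a)
  exact ⟨g, hg, fun n ↦ by rw [hc n, sum_inv_smul_dft_mul_stdAddChar]⟩

/-- **The cut along a `Q`-periodic index predicate, function exposed.** For `F : ModularForm (Gamma1 L) k`, `Q ≥ 1` and a `Q`-periodic
decidable predicate `P : ℕ → Prop`: with `a := 𝟙_P` read on `ℤ/Q` (`a j = if P j.val then 1 else 0`) and `b = Q⁻¹ • 𝓕a`, the translate sum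
`z ↦ Σ_j b(j) F((j.val/Q) +ᵥ z)` is (the function of) a `ModularForm (Gamma1 (L Q²)) k` with `coeff n = if P n then coeff n (qExpansion 1 F) else 0`
— the away-from-`q` vehicle of the flipped-cusp rung as an explicit translate sum (so `hinv` transfers to it termwise).
[cite: Shimura1971, Prop. 3.64] -/
theorem exists_modularForm_periodicCut_coe_eq {L : ℕ} [NeZero L] {k : ℤ} (F : ModularForm (Gamma1 L) k) (Q : ℕ) [NeZero Q]
    (P : ℕ → Prop) [DecidablePred P] (hP : Periodic P Q) :
    ∃ g : ModularForm (Gamma1 (L * Q ^ 2)) k,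
      (∀ z : ℍ, g z = ∑ j : ZMod Q,
        ((Q : ℂ)⁻¹ • ZMod.dft (fun i : ZMod Q ↦ if P i.val then (1 : ℂ) else 0)) j * F (((j.val : ℝ) / (Q : ℝ)) +ᵥ z)) ∧
      ∀ n : ℕ, (qExpansion 1 ⇑g).coeff n = if P n then (qExpansion 1 ⇑F).coeff n else 0 := by
  obtain ⟨g, hg, hc⟩ := exists_modularForm_periodicTwist_coe_eq F Q fun i : ZMod Q ↦ if P i.val then (1 : ℂ) else 0
  refine ⟨g, hg, fun n ↦ ?_⟩
  rw [hc n, ZMod.val_natCast]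
  have hPn : P (n % Q) ↔ P n := by
    have := hP.map_mod_nat n
    exact Iff.of_eq this
  by_cases h : P n
  · rw [if_pos (hPn.mpr h), if_pos h, one_mul]
  · rw [if_neg (fun h' ↦ h (hPn.mp h')), if_neg h, zero_mul]

end Summit.BirchSwinnertonDyer.BirchSwinnertonDyer.Theorems.PrintCFram.FlipRung

end
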